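import Literature.AnabelianGeometry.SemiGraphs.NodNonEdgeVerticialIncidence
import Literature.AnabelianGeometry.SemiGraphs.PSCIrreducibleNodalCommTerminal
import Literature.GroupTheory.CombinatorialGroupTheory.PuncturedSurfaceGroupCuspBases
import HarnessLib

/-!
# [NodNon] Lemma 1.7 (containment clause) at IRREDUCIBLE ONE-NODAL data: the cyclic-level argument

Hoshi–Mochizuki, *On the combinatorial anabelian geometry of nodally nondegenerate outer representations*,
Hiroshima Math. J. **41** (2011), Lemma 1.7 p. 290 [cite: HoshiMochizukiNodNon2011, Lem 1.7 p.290]: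
"if `Π_ṽ ∩ Π_ẽ ≠ {1}`, then `Π_ẽ ⊆ Π_ṽ`" — typed over abc-iut-L3's `PSCDatum` in coset coordinates as
`PSCDatum.EdgeVerticialContainment` (`NodNonEdgeVerticialIncidence.lean`, row «NODNON-LEM17@PSC»; never
asserted).  The criterion of `NodNonEdgeVerticialIncidenceProofs.lean` needs MALNORMAL vertex groups; at
abc-iut-f-164's IRREDUCIBLE ONE-NODAL carrier (`Δ_irr`: one vertex with a loop; `ι : Γ_{g,r+2} → Π` a
profinite pro-`Σ` completion, `Π_ν = cl ι⟨b_0⟩`, `Π_{c_j} = cl ι⟨c_j⟩`,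
`Π_v = cl ι⟨b_0, a_0 b_0 a_0⁻¹, a_i, b_i (i ≥ 1), c_j⟩`) the vertex group is NOT malnormal
(`Π_v ∩ ι(a_0) Π_v ι(a_0)⁻¹ ⊇ ι(a_0) Π_ν ι(a_0)⁻¹`), and this file supplies the instance there.

PROOF-ONLY file (abc-iut-w5-d174 gen 6).  THE ARGUMENT (cyclic level, `FreeGroupCyclicKernelBasis.lean` /
`PSCIrreducibleNodalCommTerminal.lean`): with `ℓ ∈ Σ`, `V_ℓ ⊴ Π` the kernel of the continuous extension of the
`a_0`-exponent sum mod `ℓ`, every `z ∈ Π` is `w · ι(a_0)^i` (`w ∈ V_ℓ`, `0 ≤ i < ℓ`); inside `V_ℓ` — the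
pro-`Σ` completion of `K_ℓ = Ker(Γ → ℤ/ℓ)` with Schreier basis `{a_0^j x a_0^{-j}} ∪ {a_0^ℓ}` — `Π_v` is the
closure of the sub-basis `S = {(x,0)} ∪ {(b_0,1)}` and `ι(a_0)^i cl ι⟨y⟩ ι(a_0)^{-i}` (`y` a letter `≠ a_0`)
the closure of the one-element sub-basis `{(y, i)}`: if `(y,i) ∈ S` a non-trivial `Π_v ∩ w(·)w⁻¹` forces
`w ∈ Π_v` (free-factor MALNORMALITY inside `V_ℓ`, abc-iut-L5-t6) hence containment; if `(y,i) ∉ S` the two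
sub-bases are disjoint and the intersection is trivial (`freeFactor_inf_conj_eq_bot_of_disjoint`).

* `IsProSigmaCompletion.hnnVertex_conj_zpowers_le_of_inf_ne_bot` — the ENGINE: for the HNN vertex group
  `A = ⟨b(X ∖ {t}), (b t)(b x₀)(b t)⁻¹⟩` of ANY free basis and ANY letter `y ≠ t`:
  `cl ι(A) ∩ z·cl ι⟨b y⟩·z⁻¹ ≠ 1 ⇒ z·cl ι⟨b y⟩·z⁻¹ ≤ cl ι(A)` for all `z ∈ Π`;
* `PSCDatum.edgeVerticialContainment_of_irreducibleNodal_affine` — **`EdgeVerticialContainment` at EVERY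
  irreducible one-nodal datum with at least two cusps**: the node (`y = b_0`) and the cusps `c_j`, `j ≥ 1`,
  in the `c_0`-eliminating basis; the cusp `c_0` in the `c_1`-eliminating basis
  (`exists_mulEquiv_freeGroup_elim_second`), in which `Π_v` has the same HNN shape
  (`irreducibleNodal_vertexClosure_eq_elimSecond`); together with the abutment clause
  (`NodNonEdgeVerticialIncidenceProofs.lean`, one vertex) this is [NodNon] Lem. 1.7 (ii) ⇒ (i) + containment
  at `Δ_irr`.

HONEST SCOPE: at least two cusps (with one cusp `c_0 = (∏[a_i,b_i])⁻¹` lies in no free basis); `Γ_{g,0}`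
not treated.  A shape instance is consistency evidence for the typed predicate, not the printed lemma for
all semi-graphs of anabelioids of PSC-type (cell FOUNDATIONS rows 13–14).  0 definitions; nothing here takes
a side on [IUTchIII] Cor. 3.12.
-/

noncomputable section

open scoped Pointwise

namespace Literature.AnabelianGeometry.SemiGraphs

open Literature.AnabelianGeometry.Anabelioids (IsSigmaInteger)
open Literature.GroupTheory.CombinatorialGroupTheory
open Multiplicative Topology

universe u v

/-! ### Bookkeeping -/

section Bookkeeping

variable {P : Type v} [Group P]

/-- `MulAut.conj g • H` is `ConjAct.toConjAct g • H`. [folklore] -/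
private theorem mulAut_conj_smul_eq' (g : P) (H : Subgroup P) :
    MulAut.conj g • H = ConjAct.toConjAct g • H := by
  ext x
  rw [Subgroup.mem_pointwise_smul_iff_inv_smul_mem, Subgroup.mem_pointwise_smul_iff_inv_smul_mem]
  simp [ConjAct.smul_def, MulAut.conj_symm_apply]

/-- `f (a H a⁻¹) = f(a) f(H) f(a)⁻¹`. [folklore] -/
private theorem map_toConjAct_smul₃ {Γ : Type*} [Group Γ] (f : Γ →* P) (a : Γ) (H : Subgroup Γ) :
    (ConjAct.toConjAct a • H).map f = ConjAct.toConjAct (f a) • H.map f := by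
  rw [← map_conj_eq_conjAct_smul, ← map_conj_eq_conjAct_smul, Subgroup.map_map, Subgroup.map_map]
  congr 1
  ext x
  simp [MulAut.conj_apply]

/-- Conjugating a cyclic subgroup: `a ⟨u⟩ a⁻¹ = ⟨a u a⁻¹⟩`. [folklore] -/
private theorem toConjAct_smul_zpowers (a u : P) :
    ConjAct.toConjAct a • Subgroup.zpowers u = Subgroup.zpowers (a * u * a⁻¹) := by
  rw [← map_conj_eq_conjAct_smul, MonoidHom.map_zpowers]
  rfl

/-- **Reduction of the containment clause to `g = 1`.**  If `A ∩ zEz⁻¹ ≠ 1 ⇒ zEz⁻¹ ≤ A` for all `z`, then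
`gAg⁻¹ ∩ hEh⁻¹ ≠ 1 ⇒ hEh⁻¹ ≤ gAg⁻¹`. [cite: HoshiMochizukiNodNon2011, Lem 1.7 p.290] -/
theorem conj_le_conj_of_reduced {A E : Subgroup P}
    (hz : ∀ z : P, A ⊓ ConjAct.toConjAct z • E ≠ ⊥ → ConjAct.toConjAct z • E ≤ A) (g h : P)
    (hne : MulAut.conj g • A ⊓ MulAut.conj h • E ≠ ⊥) : MulAut.conj h • E ≤ MulAut.conj g • A := by
  rw [mulAut_conj_smul_eq', mulAut_conj_smul_eq'] at hne ⊢
  have hred : A ⊓ ConjAct.toConjAct (g⁻¹ * h) • E ≠ ⊥ := by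
    intro hb
    apply hne
    have heq : ConjAct.toConjAct g • A ⊓ ConjAct.toConjAct h • E =
        ConjAct.toConjAct g • (A ⊓ ConjAct.toConjAct (g⁻¹ * h) • E) := by
      rw [Subgroup.smul_inf, ← mul_smul, ← map_mul, mul_inv_cancel_left]
    rw [heq, hb, Subgroup.smul_bot]
  have hle := hz (g⁻¹ * h) hred
  have := Subgroup.pointwise_smul_le_pointwise_smul_iff (a := ConjAct.toConjAct g) |>.mpr hle
  rwa [← mul_smul, ← map_mul, mul_inv_cancel_left] at this

end Bookkeeping

/-! ### The engine: conjugates of a letter's cyclic group against the HNN vertex group -/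

namespace SemiGraphOfAnabelioids.IsProSigmaCompletion

variable {Sigma : Set ℕ} {Γ : Type u} [Group Γ] {P : Type v} [Group P] [TopologicalSpace P]
  [IsTopologicalGroup P] [CompactSpace P] [T2Space P] [TotallyDisconnectedSpace P] {ι : Γ →* P}

/-- **The containment clause for the HNN vertex group and a letter, by the cyclic level.**  Let
`ι : Γ → Π` be a profinite pro-`Σ` completion of a group free on `b : X → Γ`, `t ∈ X`, `ℓ ∈ Σ` prime,
`χ₁` the `t`-exponent sum mod `ℓ`, `A = ⟨b x (x ≠ t), (b t)(b x₀)(b t)⁻¹⟩` (`x₀ ≠ t`) and `y ≠ t` a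
letter.  Then for every `z ∈ Π`: if `cl ι(A) ∩ z · cl ι⟨b y⟩ · z⁻¹ ≠ 1` then `z · cl ι⟨b y⟩ · z⁻¹ ≤ cl ι(A)`.
(Write `z = w ι(b t)^i`, `w ∈ V_ℓ`; inside `V_ℓ`, `cl ι(A)` and `ι(b t)^i cl ι⟨b y⟩ ι(b t)^{-i}` are the
closures of the sub-bases `S` and `{(y,i)}` of the Schreier basis of `Ker χ₁`; malnormality if `(y,i) ∈ S`,
disjointness otherwise.) [cite: HoshiMochizukiNodNon2011, Lem 1.7 p.290] -/
theorem hnnVertex_conj_zpowers_le_of_inf_ne_bot (hι : IsProSigmaCompletion Sigma ι)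
    {X : Type u} [DecidableEq X] (b : FreeGroupBasis X Γ) (t₀ : X) {ℓ : ℕ} (hℓ : ℓ.Prime)
    (hℓS : ℓ ∈ Sigma) (χ₁ : Γ →* Multiplicative (ZMod ℓ))
    (hχ₁ : ∀ x, χ₁ (b x) = if x = t₀ then ofAdd (1 : ZMod ℓ) else 1)
    {x₀ : X} (hx₀ : x₀ ≠ t₀) {y : X} (hy : y ≠ t₀) (z : P)
    (hne : ((Subgroup.closure ({g : Γ | ∃ x : X, x ≠ t₀ ∧ g = b x} ∪ {b t₀ * b x₀ * (b t₀)⁻¹})).map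
        ι).topologicalClosure ⊓
      ConjAct.toConjAct z • ((Subgroup.zpowers (b y)).map ι).topologicalClosure ≠ ⊥) :
    ConjAct.toConjAct z • ((Subgroup.zpowers (b y)).map ι).topologicalClosure ≤
      ((Subgroup.closure ({g : Γ | ∃ x : X, x ≠ t₀ ∧ g = b x} ∪ {b t₀ * b x₀ * (b t₀)⁻¹})).map
        ι).topologicalClosure := by
  classical
  haveI : Fact ℓ.Prime := ⟨hℓ⟩
  haveI : NeZero ℓ := ⟨hℓ.ne_zero⟩
  letI : TopologicalSpace (Multiplicative (ZMod ℓ)) := ⊥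
  haveI : DiscreteTopology (Multiplicative (ZMod ℓ)) := ⟨rfl⟩
  -- (1) the continuous extension `Χ₁ : Π → ℤ/ℓ` of `χ₁` and the level `V₁ = Ker Χ₁`
  have hcard : IsSigmaInteger Sigma (Nat.card (Multiplicative (ZMod ℓ))) := by
    rw [Nat.card_congr Multiplicative.toAdd, Nat.card_zmod]
    exact ⟨hℓ.pos, fun p hp hdvd => by rwa [(Nat.prime_dvd_prime_iff_eq hp hℓ).mp hdvd]⟩
  obtain ⟨Χ₁, hΧ₁c, hΧ₁⟩ := exists_continuous_extend_top hι hcard χ₁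
  set V₁ : Subgroup P := Χ₁.ker with hV₁def
  have hV₁o : IsOpen (V₁ : Set P) := by
    rw [hV₁def, MonoidHom.coe_ker]
    exact (isOpen_discrete _).preimage hΧ₁c
  have hV₁K : V₁.comap ι = χ₁.ker := by
    ext γ
    rw [Subgroup.mem_comap, hV₁def, MonoidHom.mem_ker, MonoidHom.mem_ker, hΧ₁]
  have hmem : ∀ k : χ₁.ker, (ι.comp χ₁.ker.subtype) k ∈ V₁ := fun k => by
    show Χ₁ (ι (k : Γ)) = 1
    rw [hΧ₁]
    exact k.2
  set ι₁ : χ₁.ker →* V₁ := (ι.comp χ₁.ker.subtype).codRestrict V₁ hmem with hι₁def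
  have hι₁ : IsProSigmaCompletion Sigma ι₁ :=
    restrict_comp_of_range_eq hι V₁ hV₁o χ₁.ker.subtype Subtype.coe_injective
      (by rw [Subgroup.range_subtype, hV₁K]) hmem
  haveI : CompactSpace V₁ := isCompact_iff_compactSpace.mp (V₁.isClosed_of_isOpen hV₁o).isCompact
  have hembed : IsClosedEmbedding (V₁.subtype : V₁ → P) :=
    (V₁.isClosed_of_isOpen hV₁o).isClosedEmbedding_subtypeVal
  have hcomp : V₁.subtype.comp ι₁ = ι.comp χ₁.ker.subtype := MonoidHom.ext fun k => rfl
  -- (2) the Schreier basis and the sub-basis of the vertex group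
  obtain ⟨bK, hbK, -⟩ := b.exists_freeGroupBasis_cyclicKernel t₀ ℓ χ₁ hχ₁
  set S : Set (({x : X // x ≠ t₀} × ZMod ℓ) ⊕ Unit) :=
    (Set.range fun x : {x : X // x ≠ t₀} => Sum.inl (x, (0 : ZMod ℓ))) ∪
      {Sum.inl (⟨x₀, hx₀⟩, (1 : ZMod ℓ))} with hSdef
  set A : Subgroup Γ := Subgroup.closure ({g : Γ | ∃ x : X, x ≠ t₀ ∧ g = b x} ∪
    {b t₀ * b x₀ * (b t₀)⁻¹}) with hAdef
  have hA : A = (Subgroup.closure (bK '' S)).map χ₁.ker.subtype := by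
    rw [hAdef, hSdef, ← b.closure_hnnVertex_eq_map_closure_image t₀ ℓ hℓ.two_le χ₁ bK hbK ⟨x₀, hx₀⟩]
  set A' : Subgroup V₁ := ((Subgroup.closure (bK '' S)).map ι₁).topologicalClosure with hA'def
  have hAv : (A.map ι).topologicalClosure = A'.map V₁.subtype := by
    rw [hA'def, ← topologicalClosure_map_of_isClosedEmbedding V₁.subtype hembed, Subgroup.map_map, hcomp,
      ← Subgroup.map_map, ← hA]
  -- (3) `z = w · ι(b t₀)^i` with `w ∈ V₁`
  set k : ZMod ℓ := toAdd (Χ₁ z) with hk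
  set w : P := z * (ι (b t₀) ^ k.val)⁻¹ with hw
  have hz : z = w * ι (b t₀) ^ k.val := by rw [hw, inv_mul_cancel_right]
  have hwV : w ∈ V₁ := by
    rw [hV₁def, MonoidHom.mem_ker, hw, map_mul, map_inv, map_pow, hΧ₁, hχ₁, if_pos rfl, ← ofAdd_nsmul,
      nsmul_eq_mul, mul_one, ZMod.natCast_zmod_val, hk, ofAdd_toAdd, mul_inv_cancel]
  -- (4) the conjugate of `cl ι⟨b y⟩` by `ι(b t₀)^i` is the closure of the level letter `(y, k)`
  set κ₀ : ({x : X // x ≠ t₀} × ZMod ℓ) ⊕ Unit := Sum.inl (⟨y, hy⟩, k) with hκ₀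
  set Bm : Subgroup V₁ := ((Subgroup.closure (bK '' {κ₀})).map ι₁).topologicalClosure with hBmdef
  have hletter : ((bK κ₀ : χ₁.ker) : Γ) = b t₀ ^ k.val * b y * (b t₀ ^ k.val)⁻¹ := hbK ⟨y, hy⟩ k
  have hBm : ConjAct.toConjAct (ι (b t₀) ^ k.val) • ((Subgroup.zpowers (b y)).map ι).topologicalClosure =
      Bm.map V₁.subtype := by
    rw [← map_pow, ← topologicalClosure_conjAct_smul, ← map_toConjAct_smul₃, toConjAct_smul_zpowers,
      ← hletter, ← Subgroup.coe_subtype, ← MonoidHom.map_zpowers, Subgroup.zpowers_eq_closure,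
      ← Set.image_singleton, Subgroup.map_map, ← hcomp, ← Subgroup.map_map,
      topologicalClosure_map_of_isClosedEmbedding V₁.subtype hembed]
  have hconj : ConjAct.toConjAct z • ((Subgroup.zpowers (b y)).map ι).topologicalClosure =
      (ConjAct.toConjAct (⟨w, hwV⟩ : V₁) • Bm).map V₁.subtype := by
    rw [hz, map_mul, mul_smul, hBm, map_toConjAct_smul₃]
    rfl
  -- (5) pull the hypothesis into `V₁`
  have hne' : A' ⊓ ConjAct.toConjAct (⟨w, hwV⟩ : V₁) • Bm ≠ ⊥ := by
    intro hb
    apply hne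
    rw [hAv, hconj, ← Subgroup.map_inf_eq _ _ V₁.subtype Subtype.coe_injective, hb,
      Subgroup.map_bot]
  -- (6) the two cases
  rw [hconj, hAv]
  by_cases hκS : κ₀ ∈ S
  · -- the level letter belongs to the vertex sub-basis: malnormality of `A'` in `V₁`
    have hBA : Bm ≤ A' := Subgroup.topologicalClosure_mono (Subgroup.map_mono (Subgroup.closure_mono
      (Set.image_mono (Set.singleton_subset_iff.mpr hκS))))
    have hwA : (⟨w, hwV⟩ : V₁) ∈ A' := by
      refine mem_freeFactor_of_inf_conj_ne_bot bK S hι₁ fun hb => hne' ?_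
      rw [eq_bot_iff] at hb ⊢
      exact fun q hq => hb ⟨hq.1, Subgroup.pointwise_smul_le_pointwise_smul_iff.mpr hBA hq.2⟩
    refine Subgroup.map_mono ?_
    calc ConjAct.toConjAct (⟨w, hwV⟩ : V₁) • Bm ≤ ConjAct.toConjAct (⟨w, hwV⟩ : V₁) • A' :=
          Subgroup.pointwise_smul_le_pointwise_smul_iff.mpr hBA
      _ = A' := conjAct_smul_eq_self_of_mem hwA
  · -- disjoint sub-bases: the intersection is trivial, contradiction
    have hdisj : Disjoint S {κ₀} := Set.disjoint_singleton_right.mpr hκS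
    exact absurd (freeFactor_inf_conj_eq_bot_of_disjoint bK S {κ₀} hdisj hι₁ (⟨w, hwV⟩ : V₁)) hne'

end SemiGraphOfAnabelioids.IsProSigmaCompletion

/-! ### The instance at irreducible one-nodal data -/

namespace PSCDatum

open Literature.GroupTheory.CombinatorialGroupTheory.PuncturedSurfaceGroup (a b c cuspInertia
  exists_freeGroupBasis_elim_zero exists_mulEquiv_freeGroup_elim_second c_zero_eq ofFree ofFree_of_inl
  ofFree_of_inr ofFree_cuspProd commProd cuspProd genC)
open SemiGraphOfAnabelioids (IsProSigmaCompletion)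
open SemiGraphOfAnabelioids.IsProSigmaCompletion (hnnVertex_conj_zpowers_le_of_inf_ne_bot)

variable {P : Type} [Group P] [TopologicalSpace P] [IsTopologicalGroup P]
variable [CompactSpace P] [T2Space P] [TotallyDisconnectedSpace P] {Sigma : Set ℕ} {g r : ℕ}

/-- Evaluation of `b.lift` on a basis element. [folklore] -/
private theorem lift_apply_basis₅ {Γ : Type*} [Group Γ] {β H : Type*} [Group H] (b : FreeGroupBasis β Γ)
    (f : β → H) (i : β) : b.lift f (b i) = f i := by
  change FreeGroup.lift f (b.repr (b i)) = f i
  rw [FreeGroupBasis.repr_apply_coe, FreeGroup.lift_apply_of]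

/-- **The `c_1`-eliminating basis also displays `Π_v` in HNN shape.**  With `b₂` the free basis
`a_i, b_i, c_0, c_{j+2}` of `Γ_{g,r+2}` (`exists_mulEquiv_freeGroup_elim_second`):
`⟨b_0, a_0 b_0 a_0⁻¹, a_i, b_i (i ≥ 1), c_j⟩ = ⟨b₂ x (x ≠ a_0), a_0 b_0 a_0⁻¹⟩` — the only non-letter `c_1`
being `c_0⁻¹ (∏[a_i,b_i])⁻¹ (∏_{j≥2} c_j)⁻¹` by the defining relation. [cite: MochizukiCombGC2007, Def 1.1(ii) p.6] -/
theorem irreducibleNodal_vertexClosure_eq_elimSecond (hg : 1 ≤ g)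
    (b₂ : FreeGroupBasis ((Fin g × Bool) ⊕ Fin (r + 1)) (PuncturedSurfaceGroup g (r + 2)))
    (hba : ∀ i, b₂ (Sum.inl (i, false)) = a i) (hbb : ∀ i, b₂ (Sum.inl (i, true)) = b i)
    (hb0 : b₂ (Sum.inr 0) = c 0) (hbc : ∀ j : Fin r, b₂ (Sum.inr (Fin.succ j)) = c (Fin.succ (Fin.succ j))) :
    Subgroup.closure {x : PuncturedSurfaceGroup g (r + 2) |
        x = b ⟨0, hg⟩ ∨ x = a ⟨0, hg⟩ * b ⟨0, hg⟩ * (a ⟨0, hg⟩)⁻¹ ∨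
        (∃ i : Fin g, 1 ≤ (i : ℕ) ∧ (x = a i ∨ x = b i)) ∨ ∃ j : Fin (r + 2), x = c j} =
      Subgroup.closure ({x : PuncturedSurfaceGroup g (r + 2) |
          ∃ y : (Fin g × Bool) ⊕ Fin (r + 1), y ≠ Sum.inl (⟨0, hg⟩, false) ∧ x = b₂ y} ∪
        {b₂ (Sum.inl (⟨0, hg⟩, false)) * b₂ (Sum.inl (⟨0, hg⟩, true)) *
          (b₂ (Sum.inl (⟨0, hg⟩, false)))⁻¹}) := by
  set R : Subgroup (PuncturedSurfaceGroup g (r + 2)) :=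
    Subgroup.closure ({x : PuncturedSurfaceGroup g (r + 2) |
        ∃ y : (Fin g × Bool) ⊕ Fin (r + 1), y ≠ Sum.inl (⟨0, hg⟩, false) ∧ x = b₂ y} ∪
      {b₂ (Sum.inl (⟨0, hg⟩, false)) * b₂ (Sum.inl (⟨0, hg⟩, true)) *
        (b₂ (Sum.inl (⟨0, hg⟩, false)))⁻¹}) with hR
  have hmem : ∀ y : (Fin g × Bool) ⊕ Fin (r + 1), y ≠ Sum.inl (⟨0, hg⟩, false) → b₂ y ∈ R :=
    fun y hy => Subgroup.subset_closure (Or.inl ⟨y, hy, rfl⟩)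
  have hbR : ∀ i, b i ∈ R := fun i => by
    rw [← hbb]; exact hmem _ (by simp)
  have haR : ∀ i : Fin g, 1 ≤ (i : ℕ) → a i ∈ R := fun i hi => by
    rw [← hba]
    refine hmem _ fun h => ?_
    simp only [Sum.inl.injEq, Prod.mk.injEq, and_true] at h
    rw [h] at hi
    exact Nat.not_succ_le_zero 0 hi
  have hconjR : a ⟨0, hg⟩ * b ⟨0, hg⟩ * (a ⟨0, hg⟩)⁻¹ ∈ R := by
    rw [← hba, ← hbb]; exact Subgroup.subset_closure (Or.inr rfl)
  have hc0R : c 0 ∈ R := by rw [← hb0]; exact hmem _ Sum.inr_ne_inl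
  have hcR : ∀ j : Fin r, c (Fin.succ (Fin.succ j)) ∈ R := fun j => by rw [← hbc]; exact hmem _ Sum.inr_ne_inl
  have hcommR : ∀ i : Fin g, a i * b i * (a i)⁻¹ * (b i)⁻¹ ∈ R := by
    intro i
    by_cases hi : 1 ≤ (i : ℕ)
    · exact R.mul_mem (R.mul_mem (R.mul_mem (haR i hi) (hbR i)) (R.inv_mem (haR i hi))) (R.inv_mem (hbR i))
    · have hi0 : i = ⟨0, hg⟩ := Fin.ext (by simp only [not_le, Nat.lt_one_iff] at hi; exact hi)
      subst hi0
      exact R.mul_mem hconjR (R.inv_mem (hbR _))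
  -- the relation: `(∏[a_i,b_i]) · c_0 · c_1 · ∏_{j≥2} c_j = 1`, so `c_1 ∈ R`
  have hc1R : c 1 ∈ R := by
    set B := ((List.finRange r).map fun j => c (g := g) (Fin.succ (Fin.succ j))).prod with hBdef
    have hBR : B ∈ R := by
      rw [hBdef]
      refine Subgroup.list_prod_mem _ fun x hx => ?_
      obtain ⟨j, -, rfl⟩ := List.mem_map.mp hx
      exact hcR j
    have hcomm : ofFree g (r + 1) (commProd g (r + 1)) ∈ R := by
      simp only [commProd, map_list_prod, List.map_map]
      refine Subgroup.list_prod_mem _ fun x hx => ?_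
      obtain ⟨i, -, rfl⟩ := List.mem_map.mp hx
      simp only [Function.comp_apply, map_mul, map_inv, ofFree_of_inl]
      exact hcommR i
    have hY : ofFree g (r + 1) (cuspProd g (r + 1)) ∈ R := by
      have hYeq : ofFree g (r + 1) (cuspProd g (r + 1)) =
          (c 0)⁻¹ * (ofFree g (r + 1) (commProd g (r + 1)))⁻¹ := by
        conv_rhs => rw [c_zero_eq (g := g) (r := r + 1)]
        rw [mul_inv_rev, inv_inv, inv_inv, mul_inv_cancel_right]
      rw [hYeq]
      exact R.mul_mem (R.inv_mem hc0R) (R.inv_mem hcomm)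
    have hYB : ofFree g (r + 1) (cuspProd g (r + 1)) = c 1 * B := by
      rw [ofFree_cuspProd, map_list_prod, List.map_map, List.finRange_succ, List.map_cons, List.prod_cons,
        List.map_map, hBdef]
      congr 1
    have h := R.mul_mem hY (R.inv_mem hBR)
    rwa [hYB, mul_inv_cancel_right] at h
  have hcall : ∀ j : Fin (r + 2), c j ∈ R := by
    intro j
    refine Fin.cases hc0R (fun j' => Fin.cases hc1R (fun j'' => hcR j'') j') j
  apply le_antisymm
  · rw [Subgroup.closure_le]
    rintro x (rfl | rfl | ⟨i, hi, rfl | rfl⟩ | ⟨j, rfl⟩)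
    · exact hbR _
    · exact hconjR
    · exact haR i hi
    · exact hbR i
    · exact hcall j
  · rw [hR, Subgroup.closure_le]
    rintro x (⟨y, hy, rfl⟩ | rfl)
    · rcases y with ⟨i, _ | _⟩ | j
      · rw [SetLike.mem_coe, hba]
        refine Subgroup.subset_closure (Or.inr (Or.inr (Or.inl ⟨i, ?_, Or.inl rfl⟩)))
        rw [Nat.one_le_iff_ne_zero]
        intro hi0
        exact hy (by rw [show i = ⟨0, hg⟩ from Fin.ext hi0])
      · rw [SetLike.mem_coe, hbb]
        by_cases hi : 1 ≤ (i : ℕ)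
        · exact Subgroup.subset_closure (Or.inr (Or.inr (Or.inl ⟨i, hi, Or.inr rfl⟩)))
        · have hi0 : i = ⟨0, hg⟩ := Fin.ext (by simp only [not_le, Nat.lt_one_iff] at hi; exact hi)
          subst hi0
          exact Subgroup.subset_closure (Or.inl rfl)
      · refine Fin.cases ?_ (fun j' => ?_) j
        · rw [SetLike.mem_coe, hb0]
          exact Subgroup.subset_closure (Or.inr (Or.inr (Or.inr ⟨0, rfl⟩)))
        · rw [SetLike.mem_coe, hbc]
          exact Subgroup.subset_closure (Or.inr (Or.inr (Or.inr ⟨_, rfl⟩)))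
    · rw [SetLike.mem_coe, hba, hbb]
      exact Subgroup.subset_closure (Or.inr (Or.inl rfl))

/-- **[NodNon] Lemma 1.7, containment clause (`EdgeVerticialContainment`), at EVERY irreducible one-nodal
datum with at least two cusps** (`ι : Γ_{g,r+2} → Π` a profinite pro-`Σ` completion, `g ≥ 1`; abc-iut-f-164's
shape hypotheses verbatim at `r + 2`): for every vertex–edge pair and all conjugators, a non-trivial
intersection `gΠ_vg⁻¹ ∩ hΠ_eh⁻¹` forces `hΠ_eh⁻¹ ≤ gΠ_vg⁻¹` — for the NODE (the pair whose vertex group is not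
malnormal) and the cusps `c_j`, `j ≥ 1`, by the engine in the `c_0`-eliminating basis, for the cusp `c_0` in
the `c_1`-eliminating basis. [cite: HoshiMochizukiNodNon2011, Lem 1.7 p.290] -/
theorem edgeVerticialContainment_of_irreducibleNodal_affine (hne : Sigma.Nonempty)
    (hprime : ∀ p ∈ Sigma, p.Prime) (ι : PuncturedSurfaceGroup g (r + 2) →* P)
    (hι : IsProSigmaCompletion Sigma ι) (G : PSCDatum P) (hg : 1 ≤ g) (e : G.graph.C ≃ Fin (r + 2))
    (hC : ∀ c', G.cuspGp c' = ((cuspInertia (g := g) (e c')).map ι).topologicalClosure)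
    (v₀ : G.graph.V) (hV : ∀ w, w = v₀) (n₀ : G.graph.N) (hN : ∀ n, n = n₀)
    (hE : G.nodeGp n₀ = ((Subgroup.zpowers (PuncturedSurfaceGroup.b (r := r + 2) (⟨0, hg⟩ : Fin g))).map
      ι).topologicalClosure)
    (hV₀ : G.vertGp v₀ = ((Subgroup.closure {x : PuncturedSurfaceGroup g (r + 2) |
        x = PuncturedSurfaceGroup.b ⟨0, hg⟩ ∨
        x = PuncturedSurfaceGroup.a ⟨0, hg⟩ * PuncturedSurfaceGroup.b ⟨0, hg⟩ *
          (PuncturedSurfaceGroup.a ⟨0, hg⟩)⁻¹ ∨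
        (∃ i : Fin g, 1 ≤ (i : ℕ) ∧ (x = PuncturedSurfaceGroup.a i ∨ x = PuncturedSurfaceGroup.b i)) ∨
        ∃ j : Fin (r + 2), x = PuncturedSurfaceGroup.c j}).map ι).topologicalClosure) :
    G.EdgeVerticialContainment := by
  classical
  obtain ⟨ℓ, hℓS⟩ := hne
  have hℓ : ℓ.Prime := hprime ℓ hℓS
  -- the two free bases and their `a_0`-exponent characters
  obtain ⟨b₀, h0a, h0b, h0c⟩ := exists_freeGroupBasis_elim_zero g (r + 1)
  obtain ⟨e₂, h2a', h2b', h2c0', h2c'⟩ := exists_mulEquiv_freeGroup_elim_second (g := g) (r := r)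
  let b₂ : FreeGroupBasis ((Fin g × Bool) ⊕ Fin (r + 1)) (PuncturedSurfaceGroup g (r + 2)) :=
    FreeGroupBasis.ofRepr e₂
  have hb₂ : ∀ y, b₂ y = e₂.symm (FreeGroup.of y) := fun y => rfl
  have h2a : ∀ i, b₂ (Sum.inl (i, false)) = a i := fun i => by
    rw [hb₂, ← h2a' i, MulEquiv.symm_apply_apply]
  have h2b : ∀ i, b₂ (Sum.inl (i, true)) = b i := fun i => by
    rw [hb₂, ← h2b' i, MulEquiv.symm_apply_apply]
  have h2c0 : b₂ (Sum.inr 0) = c 0 := by rw [hb₂, ← h2c0', MulEquiv.symm_apply_apply]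
  have h2c : ∀ j : Fin r, b₂ (Sum.inr (Fin.succ j)) = c (Fin.succ (Fin.succ j)) := fun j => by
    rw [hb₂, ← h2c' j, MulEquiv.symm_apply_apply]
  set t₀ : (Fin g × Bool) ⊕ Fin (r + 1) := Sum.inl (⟨0, hg⟩, false) with ht₀
  have hx₀ : (Sum.inl (⟨0, hg⟩, true) : (Fin g × Bool) ⊕ Fin (r + 1)) ≠ t₀ := by simp [ht₀]
  let χ₀ : PuncturedSurfaceGroup g (r + 2) →* Multiplicative (ZMod ℓ) :=
    b₀.lift fun y => if y = t₀ then ofAdd (1 : ZMod ℓ) else 1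
  have hχ₀ : ∀ y, χ₀ (b₀ y) = if y = t₀ then ofAdd (1 : ZMod ℓ) else 1 := fun y => lift_apply_basis₅ b₀ _ y
  let χ₂ : PuncturedSurfaceGroup g (r + 2) →* Multiplicative (ZMod ℓ) :=
    b₂.lift fun y => if y = t₀ then ofAdd (1 : ZMod ℓ) else 1
  have hχ₂ : ∀ y, χ₂ (b₂ y) = if y = t₀ then ofAdd (1 : ZMod ℓ) else 1 := fun y => lift_apply_basis₅ b₂ _ y
  -- the vertex group in both HNN shapes
  have hA₀ : G.vertGp v₀ = ((Subgroup.closure ({x : PuncturedSurfaceGroup g (r + 2) |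
      ∃ y : (Fin g × Bool) ⊕ Fin (r + 1), y ≠ t₀ ∧ x = b₀ y} ∪
        {b₀ t₀ * b₀ (Sum.inl (⟨0, hg⟩, true)) * (b₀ t₀)⁻¹})).map ι).topologicalClosure := by
    rw [hV₀, irreducibleNodal_vertexClosure_eq hg b₀ h0a h0b h0c]
  have hA₂ : G.vertGp v₀ = ((Subgroup.closure ({x : PuncturedSurfaceGroup g (r + 2) |
      ∃ y : (Fin g × Bool) ⊕ Fin (r + 1), y ≠ t₀ ∧ x = b₂ y} ∪
        {b₂ t₀ * b₂ (Sum.inl (⟨0, hg⟩, true)) * (b₂ t₀)⁻¹})).map ι).topologicalClosure := by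
    rw [hV₀, irreducibleNodal_vertexClosure_eq_elimSecond hg b₂ h2a h2b h2c0 h2c]
  intro v e' g' h' hne'
  rw [hV v] at hne' ⊢
  rcases e' with n | c'
  · -- the node: `y = b_0 = x₀` in the `c_0`-eliminating basis
    have hEy : G.edgeGp (Sum.inl n) =
        ((Subgroup.zpowers (b₀ (Sum.inl (⟨0, hg⟩, true)))).map ι).topologicalClosure := by
      change G.nodeGp n = _
      rw [hN n, hE, h0b]
    rw [hEy, hA₀] at hne' ⊢
    exact conj_le_conj_of_reduced
      (fun z hz => hnnVertex_conj_zpowers_le_of_inf_ne_bot hι b₀ t₀ hℓ hℓS χ₀ hχ₀ hx₀ hx₀ z hz) g' h' hne'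
  · -- the cusps: `c_0` in the `c_1`-eliminating basis, `c_{j+1}` in the `c_0`-eliminating basis
    have hEc : G.edgeGp (Sum.inr c') = ((Subgroup.zpowers (c (g := g) (e c'))).map ι).topologicalClosure :=
      hC c'
    rw [hEc] at hne' ⊢
    revert hne'
    refine Fin.cases (motive := fun j => (MulAut.conj g' • G.vertGp v₀ ⊓
        MulAut.conj h' • ((Subgroup.zpowers (c (g := g) j)).map ι).topologicalClosure ≠ ⊥) →
        MulAut.conj h' • ((Subgroup.zpowers (c (g := g) j)).map ι).topologicalClosure ≤
          MulAut.conj g' • G.vertGp v₀) ?_ (fun j => ?_) (e c')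
    · intro hne'
      rw [← h2c0, hA₂] at hne' ⊢
      exact conj_le_conj_of_reduced
        (fun z hz => hnnVertex_conj_zpowers_le_of_inf_ne_bot hι b₂ t₀ hℓ hℓS χ₂ hχ₂ hx₀ Sum.inr_ne_inl z hz)
        g' h' hne'
    · intro hne'
      rw [← h0c j, hA₀] at hne' ⊢
      exact conj_le_conj_of_reduced
        (fun z hz => hnnVertex_conj_zpowers_le_of_inf_ne_bot hι b₀ t₀ hℓ hℓS χ₀ hχ₀ hx₀ Sum.inr_ne_inl z hz)
        g' h' hne'

end PSCDatum

end Literature.AnabelianGeometry.SemiGraphs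

end
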